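import Mathlib.Analysis.Normed.Group.AddCircle
import Mathlib.Data.Int.GCD
import Mathlib.Tactic

/-!
# Route `GreenTaoLevelTwo`, crux `MNTwo` (stmt-Parity-21276), line `birth`, stub `stub_mnVertical`:
# recurrent linear functions are major arc — the fine-scale regime (GT 2008b App. A, Lemma 32 (ii))

Tool for blocks V4–V5 of the `stub_mnVertical` census (B. Green, T. Tao, *Quadratic uniformity of
the Möbius function*, Ann. Inst. Fourier 58 (2008) = arXiv:math/0606087, Appendix A, Lemma 32 (ii)
"Recurrent linear functions are major arc": if `‖α l‖_{ℝ/ℤ} ≤ δ₁` for at least `δ₂|I|` elements of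
an interval `I` then `‖qα‖_{ℝ/ℤ} ≪ δ₁ δ₂^{-O(1)} |I|^{-1}` for some `q ≪ δ₂^{-O(1)}`).  The printed
proof (Erdős–Turán + amplification by block sums) implicitly needs the block length
`m ≍ δ₂²/δ₁` to be at most `|I|`, i.e. `δ₁ ≳ δ₂²/|I|`; this file proves the COMPLEMENTARY fine-scale
regime `δ₁ |I| < 1/4` (which is the regime of the applications in §10, Lemma 24, and §11, Lemma 27,
where `δ₁ ≈ |I|^{-2}`) by an elementary lattice argument, with a BETTER conclusion: if
`4δ₁|I| < 1` and `δ₂|I| ≥ 2` then `‖qα‖ ≤ 4δ₁/(δ₂|I|)` for some `1 ≤ q ≤ 2/δ₂`.  Argument: for two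
returns `d₁, d₂ ≤ |I|` (differences of good points) the integer `d₁ round(d₂α) − d₂ round(d₁α)` has
absolute value `≤ 4δ₁|I| < 1`, so all the vectors `(d, round(dα))` are parallel; reducing one of them
by its gcd gives `(q, m)` with `q ∣ d` for every return `d`, whence the good points lie in a
progression of step `q` (so `q ≤ 2/δ₂` and the longest return is `≥ q δ₂|I|/2`) and
`|qα − m| ≤ 2δ₁/(δ₂|I|/2)`.  Def-free.

* `mul_round_eq_mul_round` — parallelism of short returns;
* `exists_norm_mul_le_of_many_tiny` — **Lemma 32 (ii), fine-scale regime**.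

References: [GreenTao2008QuadraticMobius] arXiv:math/0606087 App. A, Lemma 32 (ii).
-/

noncomputable section

open Finset Real

namespace Summit.Parity.GeneralizedHardyLittlewood.GreenTaoLevelTwoMNTwoRecurrentLinearTiny

/-- `‖x‖_{ℝ/ℤ} = |x − round x|` bounds the distance to the rounding. [folklore] -/
theorem abs_sub_round_eq_norm (x : ℝ) : |x - round x| = ‖((x : ℝ) : UnitAddCircle)‖ :=
  (UnitAddCircle.norm_eq).symm

/-- **Parallelism of short returns.**  If `d₁, d₂ ≤ L`, `|d₁α − m₁|, |d₂α − m₂| ≤ t` and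
`2Lt < 1`, then `d₁ m₂ = d₂ m₁`. [folklore] -/
theorem mul_eq_mul_of_short_returns {α t : ℝ} {L : ℕ} {d₁ d₂ : ℕ} {m₁ m₂ : ℤ}
    (hd₁ : d₁ ≤ L) (hd₂ : d₂ ≤ L) (h₁ : |(d₁ : ℝ) * α - m₁| ≤ t) (h₂ : |(d₂ : ℝ) * α - m₂| ≤ t)
    (hLt : 2 * L * t < 1) : (d₁ : ℤ) * m₂ = d₂ * m₁ := by
  have ht : 0 ≤ t := (abs_nonneg _).trans h₁
  have key : |(((d₁ : ℤ) * m₂ - d₂ * m₁ : ℤ) : ℝ)| < 1 := by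
    have e : (((d₁ : ℤ) * m₂ - d₂ * m₁ : ℤ) : ℝ) =
        (d₂ : ℝ) * ((d₁ : ℝ) * α - m₁) - (d₁ : ℝ) * ((d₂ : ℝ) * α - m₂) := by push_cast; ring
    rw [e]
    have hd₁' : (d₁ : ℝ) ≤ L := by exact_mod_cast hd₁
    have hd₂' : (d₂ : ℝ) ≤ L := by exact_mod_cast hd₂
    have hd₁0 : (0 : ℝ) ≤ d₁ := Nat.cast_nonneg _
    have hd₂0 : (0 : ℝ) ≤ d₂ := Nat.cast_nonneg _
    calc |(d₂ : ℝ) * ((d₁ : ℝ) * α - m₁) - (d₁ : ℝ) * ((d₂ : ℝ) * α - m₂)|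
        ≤ |(d₂ : ℝ) * ((d₁ : ℝ) * α - m₁)| + |(d₁ : ℝ) * ((d₂ : ℝ) * α - m₂)| := abs_sub _ _
      _ = (d₂ : ℝ) * |(d₁ : ℝ) * α - m₁| + (d₁ : ℝ) * |(d₂ : ℝ) * α - m₂| := by
          rw [abs_mul, abs_mul, abs_of_nonneg hd₂0, abs_of_nonneg hd₁0]
      _ ≤ L * t + L * t := add_le_add (mul_le_mul hd₂' h₁ (abs_nonneg _) (hd₂0.trans hd₂'))
          (mul_le_mul hd₁' h₂ (abs_nonneg _) (hd₁0.trans hd₁'))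
      _ < 1 := by linarith
  have : ((d₁ : ℤ) * m₂ - d₂ * m₁ : ℤ) = 0 := by
    have h := key
    rw [← Int.cast_abs] at h
    have : |(d₁ : ℤ) * m₂ - d₂ * m₁| < 1 := by exact_mod_cast h
    exact Int.abs_lt_one_iff.1 this
  linarith

/-- **Recurrent linear functions are major arc, fine-scale regime (GT 2008b Lemma 32 (ii)).**  Let
`α ∈ ℝ`, `M ∈ ℤ`, `0 < δ₂`, `δ₁` with `4 δ₁ L < 1` and `δ₂ L ≥ 2`, and suppose that at least
`δ₂ L` integers `l ∈ {1, …, L}` satisfy `‖α(M+l)‖_{ℝ/ℤ} ≤ δ₁`.  Then there is `1 ≤ q ≤ 2/δ₂` with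
`‖qα‖_{ℝ/ℤ} ≤ 4δ₁/(δ₂ L)`.
[cite: GreenTao2008QuadraticMobius, Lemma 32 (ii)] -/
theorem exists_norm_mul_le_of_many_tiny (α : ℝ) (M : ℤ) {L : ℕ} {δ₁ δ₂ : ℝ} (hδ₂ : 0 < δ₂)
    (hsmall : 4 * δ₁ * L < 1) (hL : 2 ≤ δ₂ * L)
    (hcount : δ₂ * L ≤ #((Icc 1 L).filter fun l : ℕ =>
      ‖((α * ((M : ℝ) + l) : ℝ) : UnitAddCircle)‖ ≤ δ₁)) :
    ∃ q : ℕ, 1 ≤ q ∧ (q : ℝ) ≤ 2 / δ₂ ∧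
      ‖((((q : ℝ) * α : ℝ)) : UnitAddCircle)‖ ≤ 4 * δ₁ / (δ₂ * L) := by
  classical
  set G := (Icc 1 L).filter fun l : ℕ => ‖((α * ((M : ℝ) + l) : ℝ) : UnitAddCircle)‖ ≤ δ₁ with hG
  have hLpos : (0 : ℝ) < L := by
    have : (0 : ℝ) < δ₂ * L := by linarith
    exact pos_of_mul_pos_right this hδ₂.le  -- hmm
  have hcard2 : 2 ≤ #G := by
    have : (2 : ℝ) ≤ #G := hL.trans hcount
    exact_mod_cast this
  have hGne : G.Nonempty := card_pos.1 (by omega)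
  have hmemG : ∀ g ∈ G, (1 ≤ g ∧ g ≤ L) ∧ ‖((α * ((M : ℝ) + g) : ℝ) : UnitAddCircle)‖ ≤ δ₁ := by
    intro g hg; rw [hG, mem_filter, mem_Icc] at hg; exact hg
  set g₀ := G.min' hGne with hg₀
  set g₁ := G.max' hGne with hg₁
  have hg₀G : g₀ ∈ G := min'_mem _ _
  have hg₁G : g₁ ∈ G := max'_mem _ _
  have hg₀le : ∀ g ∈ G, g₀ ≤ g := fun g hg => min'_le _ _ hg
  have hleg₁ : ∀ g ∈ G, g ≤ g₁ := fun g hg => le_max' _ _ hg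
  have hg₀₁ : g₀ < g₁ := min'_lt_max'_of_card _ (by omega)
  -- returns: `d_g := g − g₀` has `‖d_g α‖ ≤ 2δ₁`, read as `|d_g α − round(d_g α)| ≤ 2δ₁`
  have hret : ∀ g ∈ G, |((g - g₀ : ℕ) : ℝ) * α - round (((g - g₀ : ℕ) : ℝ) * α)| ≤ 2 * δ₁ := by
    intro g hg
    rw [abs_sub_round_eq_norm]
    have e : ((((g - g₀ : ℕ) : ℝ) * α : ℝ) : UnitAddCircle) =
        ((α * ((M : ℝ) + g) : ℝ) : UnitAddCircle) - ((α * ((M : ℝ) + g₀) : ℝ) : UnitAddCircle) := by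
      rw [← AddCircle.coe_sub]; congr 1; push_cast [hg₀le g hg]; ring
    rw [e]
    calc _ ≤ ‖((α * ((M : ℝ) + g) : ℝ) : UnitAddCircle)‖ + ‖((α * ((M : ℝ) + g₀) : ℝ) : UnitAddCircle)‖ :=
          norm_sub_le _ _
      _ ≤ δ₁ + δ₁ := add_le_add (hmemG g hg).2 (hmemG g₀ hg₀G).2
      _ = 2 * δ₁ := by ring
  have hretL : ∀ g ∈ G, g - g₀ ≤ L := fun g hg => (Nat.sub_le _ _).trans (hmemG g hg).1.2
  have hLt : 2 * (L : ℝ) * (2 * δ₁) < 1 := by linarith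
  -- the longest return and its reduced vector `(q, m)`
  set dstar : ℕ := g₁ - g₀ with hdstar
  have hdstar_pos : 0 < dstar := by omega
  set mstar : ℤ := round ((dstar : ℝ) * α) with hmstar
  have hgcdpos : 0 < Int.gcd (dstar : ℤ) mstar :=
    Int.gcd_pos_of_ne_zero_left _ (by exact_mod_cast hdstar_pos.ne')
  obtain ⟨g, q', m', hgpos, hcop, hdq, hmq⟩ := Int.exists_gcd_one' hgcdpos
  have hq'pos : 0 < q' := by
    have : (0 : ℤ) < q' * g := by rw [← hdq]; exact_mod_cast hdstar_pos
    exact pos_of_mul_pos_left this (by exact_mod_cast hgpos.le)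
  -- every return is a multiple of `q'`
  have hdvd : ∀ x ∈ G, q' ∣ ((x - g₀ : ℕ) : ℤ) := by
    intro x hx
    have hpar := mul_eq_mul_of_short_returns (hretL x hx) (hretL g₁ hg₁G) (hret x hx) (hret g₁ hg₁G) hLt
    -- `(x−g₀)·mstar = dstar·round((x−g₀)α)`; substitute `dstar = q' g`, `mstar = m' g`
    rw [show ((g₁ - g₀ : ℕ) : ℤ) = q' * g from hdq, show round (((g₁ - g₀ : ℕ) : ℝ) * α) = m' * g
      from hmq] at hpar
    have hg0 : (g : ℤ) ≠ 0 := by exact_mod_cast hgpos.ne'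
    have h2 : ((x - g₀ : ℕ) : ℤ) * m' = q' * round (((x - g₀ : ℕ) : ℝ) * α) := by
      have : (((x - g₀ : ℕ) : ℤ) * m' - q' * round (((x - g₀ : ℕ) : ℝ) * α)) * g = 0 := by
        linarith
      rcases mul_eq_zero.1 this with h | h
      · linarith
      · exact absurd h hg0
    exact Int.dvd_of_dvd_mul_left_of_gcd_one ⟨_, h2⟩ hcop
  -- hence `G ⊆ {g₀ + q j : j ≤ g}` and `#G ≤ g + 1`
  set q : ℕ := q'.toNat with hq
  have hqq' : (q : ℤ) = q' := Int.toNat_of_nonneg hq'pos.le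
  have hq1 : 1 ≤ q := by omega
  have hdq' : dstar = q * g := by
    have : ((dstar : ℕ) : ℤ) = ((q * g : ℕ) : ℤ) := by push_cast; rw [hqq']; exact hdq
    exact_mod_cast this
  have hsub : G ⊆ (Finset.range (g + 1)).image fun j => g₀ + q * j := by
    intro x hx
    obtain ⟨j, hj⟩ := hdvd x hx
    have hj0 : 0 ≤ j := by
      have : (0 : ℤ) ≤ q' * j := by rw [← hj]; exact_mod_cast Nat.zero_le _
      exact nonneg_of_mul_nonneg_right this hq'pos  -- hmm sign lemma
    rw [mem_image]
    refine ⟨j.toNat, ?_, ?_⟩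
    · rw [mem_range]
      -- `q j = x − g₀ ≤ dstar = q g`
      have h1 : ((x - g₀ : ℕ) : ℤ) ≤ dstar := by exact_mod_cast Nat.sub_le_sub_right (hleg₁ x hx) g₀
      rw [hj, hdq] at h1
      have h2 : j ≤ g := le_of_mul_le_mul_left h1 hq'pos
      omega
    · have : ((g₀ + q * j.toNat : ℕ) : ℤ) = x := by
        push_cast
        rw [Int.toNat_of_nonneg hj0, hqq', ← hj]
        push_cast [hg₀le x hx]
        ring
      exact_mod_cast this
  have hcardG : #G ≤ g + 1 := by
    calc #G ≤ #((Finset.range (g + 1)).image fun j => g₀ + q * j) := card_le_card hsub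
      _ ≤ #(Finset.range (g + 1)) := card_image_le
      _ = g + 1 := card_range _
  have hg_ge : δ₂ * L / 2 ≤ g := by
    have h1 : δ₂ * L ≤ (g : ℝ) + 1 := hcount.trans (by exact_mod_cast hcardG)
    linarith
  have hgposR : (0 : ℝ) < g := by exact_mod_cast hgpos
  -- conclusion
  refine ⟨q, hq1, ?_, ?_⟩
  · -- `q g = dstar ≤ L` and `g ≥ δ₂ L / 2`
    have h1 : (q : ℝ) * g ≤ L := by
      have : q * g ≤ L := hdq' ▸ hretL g₁ hg₁G
      exact_mod_cast this
    rw [le_div_iff₀ hδ₂]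
    nlinarith
  · -- `|q α − m'| = |dstar α − mstar| / g ≤ 2δ₁/g ≤ 4δ₁/(δ₂ L)`
    have hmain : |(q : ℝ) * α - m'| * g ≤ 2 * δ₁ := by
      have hm' : ((mstar : ℤ) : ℝ) = (m' : ℝ) * (g : ℝ) := by rw [hmq]; push_cast; ring
      have e : |(q : ℝ) * α - m'| * g = |((dstar : ℕ) : ℝ) * α - mstar| := by
        rw [hm', hdq']
        calc |(q : ℝ) * α - m'| * g = |(q : ℝ) * α - m'| * |(g : ℝ)| := by rw [abs_of_pos hgposR]
          _ = |((q : ℝ) * α - m') * g| := (abs_mul _ _).symm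
          _ = _ := by congr 1; push_cast; ring
      rw [e]
      exact hret g₁ hg₁G
    have h1 : ‖((((q : ℝ) * α : ℝ)) : UnitAddCircle)‖ ≤ |(q : ℝ) * α - m'| := by
      rw [UnitAddCircle.norm_eq]; exact round_le _ _
    refine h1.trans ?_
    rw [le_div_iff₀ (by positivity)]
    calc |(q : ℝ) * α - m'| * (δ₂ * L) ≤ |(q : ℝ) * α - m'| * (2 * g) :=
          mul_le_mul_of_nonneg_left (by linarith) (abs_nonneg _)
      _ = 2 * (|(q : ℝ) * α - m'| * g) := by ring
      _ ≤ 2 * (2 * δ₁) := by linarith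
      _ = 4 * δ₁ := by ring

end Summit.Parity.GeneralizedHardyLittlewood.GreenTaoLevelTwoMNTwoRecurrentLinearTiny
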